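import Summits.NavierStokesRegularity.NavierStokesRegularity.Theorems.HodographBetchovClassBudgetsRegulariseSlab
import Literature.Analysis.FluidPDE.LeiZhang2017SmallSwirlContinuation
import Literature.Analysis.FluidPDE.ClassicalSobolevUniqueness
import Literature.Analysis.FluidPDE.TaoLocalisationHolds

/-!
# Crux `HodographBetchov.ClassBudgetsRegularise` (stmt-NavierStokesRegularity-16863), line `birth`,
# stub 1 `stub_classBudgetEnstrophyBound` — the Betchov–Miller enstrophy bound on velocity classes (PROVED)

Registered stub 1 (the load-bearing one) of the skeleton `Cruxes/ClassBudgetsRegularise/Lines/birth.lean`: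
along a classical solution `(u, p)` of the unforced Navier–Stokes system on `ℝ³ × [0, T)` which is
Leray–Hopf from its rapidly decaying datum, the two CLASS BUDGETS at one speed level `l > 0` — the
slow-class production bound (verbatim the conclusion of crux `SlowClassProduction` at `l`) and the
fast-class squeeze (verbatim the conclusion of crux `FastClassSqueeze` at `l`) — bound the enstrophy
uniformly on `[0, T)`.

Proof. Fix `T₁ < T`. Every Tao-class solution `(v, q)` from `u 0` on a closed slab `[0, T'] ⊆ [0, T₁]`
(Tao 2013, Thm. 5.4: `v, ∂ₜv, q ∈ L^∞_t H^k_x`) COINCIDES with `u` there (Majda–Bertozzi uniqueness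
`MajdaBertozzi2002_uniquenessSobolev_holds`; `u` has bounded Sobolev norms on `[0, T']` by Tao's
persistence `tao2011_hasBoundedSobolevNormsOn_holds`), hence inherits both class budgets, so the slab
Grönwall `classBudget_enstrophy_slab` (the content of the helper files `…Algebra`, `…Hodograph`,
`…KeyEstimate`, `…Transport`, `…Production`, `…Slice`, `…Slab`) bounds its enstrophy by a constant
`E*` depending only on `∫|∇u(0)|²`, the slow budget `C` and the total fast-class charge
`Λ = ∫₀ᵀ (∫_{l<‖u‖} m^q)^{2/(2q−3)}` — uniformly in `T' ≤ T₁ < T`. By the standard continuation method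
in Tao's class (`exists_isTaoSolutionOn_of_enstrophy_apriori`) there IS a Tao-class solution on
`[0, T₁]`, which again is `u`; so `∫‖∇u(t)‖² ≤ E*` on `[0, T₁]`, for every `T₁ < T`.

References: E. Miller, Arch. Ration. Mech. Anal. 235 (2020) = arXiv:1710.05569, Thm. 1.1 and
Lemma 5.1; R. Betchov, J. Fluid Mech. 1 (1956); T. Tao, Anal. PDE 6 (2013), Thm. 5.4, Cor. 11.1;
A. J. Majda, A. L. Bertozzi (2002), Cor. 3.1.
-/

noncomputable section

open MeasureTheory Set Function Filter Topology InnerProductSpace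
open scoped ENNReal NNReal ContDiff RealInnerProductSpace Laplacian

-- the summit and its single sub-problem share the name (CONVENTIONS §1), as in every Theorems file
set_option linter.dupNamespace false

namespace Summit.NavierStokesRegularity.NavierStokesRegularity.Theorems.ClassBudgetsRegularise.Birth

open Literature.Analysis Literature.Analysis.FluidPDE
open Summit.NavierStokesRegularity.NavierStokesRegularity.Theorems.ClassBudgetsRegularise

/-- **stub 1 — `stub_classBudgetEnstrophyBound` (the Betchov–Miller enstrophy bound on velocity
classes).** For `ν, T > 0`, a classical solution `(u, p)` of the unforced Navier–Stokes system on
`ℝ³ × [0, T)` which is Leray–Hopf from its rapidly decaying datum, and a speed level `l > 0`: the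
slow-class production bound at `l` and the fast-class squeeze at `l` imply that the enstrophy
`∫ ‖∇u(t)‖²` is bounded uniformly in `t ∈ [0, T)`. (Miller 2019, Thm. 1.1, is the case where the
middle-eigenvalue majorant is demanded on all of `ℝ³`; here it is demanded only on the fast class
`{|u| > l}` and the slow class pays with its time-integrated signed production, via Betchov on
velocity classes.) Proof: Tao-class solutions from `u 0` on closed sub-slabs coincide with `u`
(Majda–Bertozzi uniqueness + Tao persistence), inherit the budgets, and obey the slab Grönwall
`classBudget_enstrophy_slab` with a constant uniform in the sub-slab; the continuation method
`exists_isTaoSolutionOn_of_enstrophy_apriori` then produces such a solution on every `[0, T₁]`,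
`T₁ < T`. [cite: Miller2019, Thm 1.1 (proof of Thm 5.2) and Lemma 5.1] -/
theorem stub_classBudgetEnstrophyBound :
    ∀ (ν T : ℝ), 0 < ν → 0 < T → ∀ (u : ℝ → EuclideanSpace ℝ (Fin 3) → EuclideanSpace ℝ (Fin 3))
      (p : ℝ → EuclideanSpace ℝ (Fin 3) → ℝ),
      IsClassicalNSSolutionOn (Set.Ico 0 T) ν 0 u p → IsLerayHopfOn T ν 0 (u 0) u →
      HasRapidSpatialDecay (u 0) → ∀ l : ℝ, 0 < l →
      (∃ C : ℝ, ∀ t ∈ Set.Ico 0 T,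
        MeasureTheory.IntegrableOn (fun z : ℝ × EuclideanSpace ℝ (Fin 3) =>
            inner ℝ (curl (u z.1) z.2) (fderiv ℝ (u z.1) z.2 (curl (u z.1) z.2)))
          {z : ℝ × EuclideanSpace ℝ (Fin 3) | z.1 ∈ Set.Ioo 0 t ∧ ‖u z.1 z.2‖ ≤ l} ∧
        ∫ z in {z : ℝ × EuclideanSpace ℝ (Fin 3) | z.1 ∈ Set.Ioo 0 t ∧ ‖u z.1 z.2‖ ≤ l},
          inner ℝ (curl (u z.1) z.2) (fderiv ℝ (u z.1) z.2 (curl (u z.1) z.2)) ≤ C) →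
      (∃ q : ℝ, 3 / 2 < q ∧ ∃ m : ℝ → EuclideanSpace ℝ (Fin 3) → ℝ, (∀ t x, 0 ≤ m t x) ∧
        (∀ t ∈ Set.Ico 0 T, ∀ x, l < ‖u t x‖ → ∃ v w : EuclideanSpace ℝ (Fin 3),
          ‖v‖ = 1 ∧ ‖w‖ = 1 ∧ inner ℝ v w = 0 ∧
          ∀ α β : ℝ, inner ℝ (fderiv ℝ (u t) x (α • v + β • w)) (α • v + β • w)
            ≤ m t x * (α ^ 2 + β ^ 2)) ∧
        ∫⁻ t in Set.Ioo 0 T, (∫⁻ x in {x : EuclideanSpace ℝ (Fin 3) | l < ‖u t x‖}, ENNReal.ofReal (m t x) ^ q)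
          ^ (2 / (2 * q - 3)) < ⊤) →
      ∃ E : ℝ, ∀ t ∈ Set.Ico 0 T, ∫⁻ x, ‖fderiv ℝ (u t) x‖ₑ ^ 2 ≤ ENNReal.ofReal E := by
  intro ν T hν hT u p hcl hLH hdec l hl hslow hfast
  obtain ⟨C, hC⟩ := hslow
  obtain ⟨r, hr, m, hm0, hclm, hΛ⟩ := hfast
  -- the datum
  have h0I : (0 : ℝ) ∈ Ico 0 T := ⟨le_rfl, hT⟩
  have hsm : ContDiff ℝ ∞ (u 0) := hcl.contDiff_velocity h0I
  have hdiv0 : VectorCalculus.IsDivFree (u 0) := hcl.divFree 0 h0I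
  have hH : ∀ n : ℕ, ∫⁻ x, ‖iteratedFDeriv ℝ n (u 0) x‖ₑ ^ 2 < ⊤ := fun n =>
    hdec.lintegral_enorm_iteratedFDeriv_sq_lt_top n
  -- the constant
  set KS : ℝ := (SNormLESNormFDerivOfEqConst (EuclideanSpace ℝ (Fin 3))
    (volume : Measure (EuclideanSpace ℝ (Fin 3))) 2 : ℝ) with hKS
  set κ' : ℝ := 2 * ((1 - 3 / (2 * r)) * (2 * (1 - (1 - 3 / (2 * r)))) ^ ((1 - (1 - 3 / (2 * r))) / (1 - 3 / (2 * r))) * ν ^ (-((1 - (1 - 3 / (2 * r))) / (1 - 3 / (2 * r))))) * (2 * KS ^ (2 * (1 - (1 - 3 / (2 * r))))) ^ (1 / (1 - 3 / (2 * r))) + 1 with hκ'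
  set A : ℝ → ℝ≥0∞ := fun t =>
    (∫⁻ x in {x | l < ‖u t x‖}, ENNReal.ofReal (m t x) ^ r) ^ (2 / (2 * r - 3)) with hA
  set Λ : ℝ≥0∞ := ∫⁻ t in Ioo 0 T, A t with hΛdef
  have hΛfin : Λ ≠ ⊤ := hΛ.ne
  set G0 : ℝ := ∫ x, frobeniusNormSq (fderiv ℝ (u 0) x) with hG0
  have hG00 : 0 ≤ G0 := integral_nonneg fun x => FluidPDE.frobeniusNormSq_nonneg _
  set Estar : ℝ := (G0 + 1 + 2 * max C 0) * Real.exp (κ' * Λ.toReal) with hEstar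
  have hEstar0 : 0 ≤ Estar := by positivity
  -- Tao persistence: `u` has bounded Sobolev norms on every closed sub-slab
  have hslabu : ∀ T' ∈ Ioo 0 T, HasBoundedSobolevNormsOn (Icc 0 T') u := by
    intro T' hT'
    have hsol' : IsClassicalNSSolutionOn (Icc 0 T') ν 0 u p :=
      hcl.mono (Icc_subset_Ico_right hT'.2) (uniqueDiffOn_Icc hT'.1)
    have hEn' : ∃ C' : ℝ≥0, ∀ t ∈ Icc 0 T', ∫⁻ x, ‖u t x‖ₑ ^ 2 ≤ C' :=
      ⟨(2 * VectorCalculus.kineticEnergy (u 0)).toNNReal, fun t ht =>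
        hLH.lintegral_enorm_sq_le hν.le ⟨ht.1, ht.2.trans hT'.2.le⟩⟩
    exact tao2011_hasBoundedSobolevNormsOn_holds hν hT'.1 hsol' hEn' hdec
  -- (a) every Tao-class solution from `u 0` on `[0, T'] ⊆ [0, T)` coincides with `u`
  have hcoin : ∀ T' ∈ Ioo 0 T, ∀ {v : ℝ → EuclideanSpace ℝ (Fin 3) → EuclideanSpace ℝ (Fin 3)}
      {q : ℝ → EuclideanSpace ℝ (Fin 3) → ℝ}, IsTaoSolutionOn T' ν (u 0) v q →
      ∀ t ∈ Icc 0 T', u t = v t := by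
    intro T' hT' v q hv t ht
    have hsol' : IsClassicalNSSolutionOn (Icc 0 T') ν 0 u p :=
      hcl.mono (Icc_subset_Ico_right hT'.2) (uniqueDiffOn_Icc hT'.1)
    exact MajdaBertozzi2002_uniquenessSobolev_holds hν.le hT'.1 hsol' hv.classical (hslabu T' hT')
      hv.sobolev hv.initial.symm t ht
  -- (b)+(c) the slab Grönwall for Tao-class solutions from `u 0`, uniformly in `T' < T`
  have hbound : ∀ T' ∈ Ioo 0 T, ∀ {v : ℝ → EuclideanSpace ℝ (Fin 3) → EuclideanSpace ℝ (Fin 3)}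
      {q : ℝ → EuclideanSpace ℝ (Fin 3) → ℝ}, IsTaoSolutionOn T' ν (u 0) v q →
      ∀ s ∈ Icc 0 T', ∫ x, frobeniusNormSq (fderiv ℝ (v s) x) ≤ Estar := by
    intro T' hT' v q hv s hs
    have huv : ∀ t ∈ Icc 0 T', u t = v t := hcoin T' hT' hv
    -- transfer of the slow budget
    have hsetS : ∀ b, b ≤ T' → {z : ℝ × EuclideanSpace ℝ (Fin 3) | z.1 ∈ Ioo 0 b ∧ ‖v z.1 z.2‖ ≤ l} =
        {z : ℝ × EuclideanSpace ℝ (Fin 3) | z.1 ∈ Ioo 0 b ∧ ‖u z.1 z.2‖ ≤ l} := by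
      intro b hb
      ext z
      simp only [mem_setOf_eq]
      constructor
      · rintro ⟨h1, h2⟩; exact ⟨h1, by rwa [huv z.1 ⟨h1.1.le, h1.2.le.trans hb⟩]⟩
      · rintro ⟨h1, h2⟩; exact ⟨h1, by rwa [← huv z.1 ⟨h1.1.le, h1.2.le.trans hb⟩]⟩
    have hPeq : ∀ b, b ≤ T' → ∀ z ∈ {z : ℝ × EuclideanSpace ℝ (Fin 3) | z.1 ∈ Ioo 0 b ∧ ‖u z.1 z.2‖ ≤ l},
        ⟪curl (v z.1) z.2, fderiv ℝ (v z.1) z.2 (curl (v z.1) z.2)⟫ =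
          ⟪curl (u z.1) z.2, fderiv ℝ (u z.1) z.2 (curl (u z.1) z.2)⟫ := by
      intro b hb z hz
      rw [← huv z.1 ⟨hz.1.1.le, hz.1.2.le.trans hb⟩]
    have hmS : ∀ b, b ≤ T' → MeasurableSet {z : ℝ × EuclideanSpace ℝ (Fin 3) | z.1 ∈ Ioo 0 b ∧ ‖u z.1 z.2‖ ≤ l} := by
      intro b hb
      have hcont : ContinuousOn (uncurry u) (Icc 0 T' ×ˢ univ) :=
        (hcl.mono (Icc_subset_Ico_right hT'.2) (uniqueDiffOn_Icc hT'.1)).smooth_velocity.continuousOn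
      have hO : IsOpen (Ioo (0 : ℝ) b ×ˢ (univ : Set (EuclideanSpace ℝ (Fin 3)))) := isOpen_Ioo.prod isOpen_univ
      have hc : ContinuousOn (fun z : ℝ × EuclideanSpace ℝ (Fin 3) => ‖uncurry u z‖) (Ioo 0 b ×ˢ univ) :=
        (hcont.mono (prod_mono (Ioo_subset_Icc_self.trans (Icc_subset_Icc le_rfl hb)) Subset.rfl)).norm
      have hopen : IsOpen ((Ioo (0 : ℝ) b ×ˢ (univ : Set (EuclideanSpace ℝ (Fin 3)))) ∩
          (fun z => ‖uncurry u z‖) ⁻¹' Ioi l) := hc.isOpen_inter_preimage hO isOpen_Ioi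
      have heq : {z : ℝ × EuclideanSpace ℝ (Fin 3) | z.1 ∈ Ioo 0 b ∧ ‖u z.1 z.2‖ ≤ l} =
          (Ioo (0 : ℝ) b ×ˢ (univ : Set (EuclideanSpace ℝ (Fin 3)))) \
            ((Ioo (0 : ℝ) b ×ˢ univ) ∩ (fun z => ‖uncurry u z‖) ⁻¹' Ioi l) := by
        ext z
        simp only [mem_setOf_eq, Set.mem_sdiff, mem_prod, mem_univ, and_true, mem_inter_iff, mem_preimage,
          mem_Ioi, uncurry, not_and, not_lt]
        constructor
        · rintro ⟨h1, h2⟩; exact ⟨h1, fun _ => h2⟩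
        · rintro ⟨h1, h2⟩; exact ⟨h1, h2 h1⟩
      rw [heq]
      exact hO.measurableSet.diff hopen.measurableSet
    have hT'I : T' ∈ Ico 0 T := ⟨hT'.1.le, hT'.2⟩
    obtain ⟨hIu, -⟩ := hC T' hT'I
    have hslowI : IntegrableOn (fun z : ℝ × EuclideanSpace ℝ (Fin 3) =>
        ⟪curl (v z.1) z.2, fderiv ℝ (v z.1) z.2 (curl (v z.1) z.2)⟫)
        {z : ℝ × EuclideanSpace ℝ (Fin 3) | z.1 ∈ Ioo 0 T' ∧ ‖v z.1 z.2‖ ≤ l} := by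
      rw [hsetS T' le_rfl]
      exact hIu.congr_fun (fun z hz => (hPeq T' le_rfl z hz).symm) (hmS T' le_rfl)
    have hslowv : ∀ b ∈ Ioc 0 T', ∫ z in {z : ℝ × EuclideanSpace ℝ (Fin 3) | z.1 ∈ Ioo 0 b ∧ ‖v z.1 z.2‖ ≤ l},
        ⟪curl (v z.1) z.2, fderiv ℝ (v z.1) z.2 (curl (v z.1) z.2)⟫ ≤ C := by
      intro b hb
      rw [hsetS b hb.2, setIntegral_congr_fun (hmS b hb.2) (hPeq b hb.2)]
      exact (hC b ⟨hb.1.le, hb.2.trans_lt hT'.2⟩).2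
    -- transfer of the fast squeeze
    have hclv : ∀ t ∈ Ioo 0 T', ∀ x, l < ‖v t x‖ → ∃ a b : EuclideanSpace ℝ (Fin 3),
        ‖a‖ = 1 ∧ ‖b‖ = 1 ∧ ⟪a, b⟫ = 0 ∧
        ∀ α β : ℝ, ⟪fderiv ℝ (v t) x (α • a + β • b), α • a + β • b⟫ ≤ m t x * (α ^ 2 + β ^ 2) := by
      intro t ht x hx
      rw [← huv t ⟨ht.1.le, ht.2.le⟩] at hx ⊢
      exact hclm t ⟨ht.1.le, ht.2.trans hT'.2⟩ x hx
    have hAeq : ∀ t ∈ Ioo 0 T', (∫⁻ x in {x | l < ‖v t x‖}, ENNReal.ofReal (m t x) ^ r) ^ (2 / (2 * r - 3)) = A t := by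
      intro t ht
      rw [hA]; simp only
      rw [← huv t ⟨ht.1.le, ht.2.le⟩]
    have hΛv_le : ∫⁻ t in Ioo 0 T', (∫⁻ x in {x | l < ‖v t x‖}, ENNReal.ofReal (m t x) ^ r) ^ (2 / (2 * r - 3)) ≤ Λ := by
      calc ∫⁻ t in Ioo 0 T', (∫⁻ x in {x | l < ‖v t x‖}, ENNReal.ofReal (m t x) ^ r) ^ (2 / (2 * r - 3))
          = ∫⁻ t in Ioo 0 T', A t := setLIntegral_congr_fun measurableSet_Ioo hAeq
        _ ≤ Λ := lintegral_mono_set (Ioo_subset_Ioo le_rfl hT'.2.le)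
    have hΛv : ∫⁻ t in Ioo 0 T', (∫⁻ x in {x | l < ‖v t x‖}, ENNReal.ofReal (m t x) ^ r) ^ (2 / (2 * r - 3)) ≠ ⊤ :=
      ne_top_of_le_ne_top hΛfin hΛv_le
    -- the slab Grönwall for `(v, q)` on `[0, T']`
    have hslab := classBudget_enstrophy_slab hν hT'.1 hv.classical hv.sobolev hv.sobolev_dt hv.sobolev_p
      hl hslowI hslowv hr hm0 hclv hΛv s hs
    have hv0 : v 0 = u 0 := hv.initial
    rw [hv0] at hslab
    refine hslab.trans ?_
    rw [hEstar]
    refine mul_le_mul_of_nonneg_left (Real.exp_le_exp.2 ?_) (by positivity)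
    have hκ'0 : 0 ≤ κ' := by
      rw [hκ']
      have hr0 : 0 < r := by linarith
      have h1θ : 0 < 1 - (1 - 3 / (2 * r)) := by
        have : (0 : ℝ) < 3 / (2 * r) := by positivity
        linarith
      have hθ0 : 0 < 1 - 3 / (2 * r) := by
        rw [sub_pos, div_lt_one (by linarith)]; linarith
      positivity
    exact mul_le_mul_of_nonneg_left (ENNReal.toReal_mono hΛfin hΛv_le) hκ'0
  -- (d) the a-priori bound in the form the continuation method consumes
  have hapriori : ∀ ⦃T' : ℝ⦄, 0 < T' → ∀ T₁ ∈ Ioo 0 T, T' ≤ T₁ →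
      ∀ ⦃v : ℝ → EuclideanSpace ℝ (Fin 3) → EuclideanSpace ℝ (Fin 3)⦄
        ⦃q : ℝ → EuclideanSpace ℝ (Fin 3) → ℝ⦄, IsTaoSolutionOn T' ν (u 0) v q →
        ∀ t ∈ Icc 0 T', ∫⁻ x, ‖iteratedFDeriv ℝ 1 (v t) x‖ₑ ^ 2 ≤ ENNReal.ofReal Estar := by
    intro T' hT'0 T₁ hT₁ hT'T₁ v q hv t ht
    have hT' : T' ∈ Ioo 0 T := ⟨hT'0, hT'T₁.trans_lt hT₁.2⟩
    have hG := hbound T' hT' hv t ht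
    have hcd : ContDiff ℝ ∞ (v t) := hv.classical.contDiff_velocity ht
    obtain ⟨C₁, hC₁⟩ := hv.sobolev 1
    have hfin : ∫⁻ x, ENNReal.ofReal (frobeniusNormSq (fderiv ℝ (v t) x)) < ⊤ := by
      calc ∫⁻ x, ENNReal.ofReal (frobeniusNormSq (fderiv ℝ (v t) x))
          ≤ ∫⁻ x, 3 * ‖iteratedFDeriv ℝ 1 (v t) x‖ₑ ^ 2 := lintegral_mono fun x => by
            rw [← ofReal_norm, norm_iteratedFDeriv_one, ofReal_norm]
            exact ofReal_frobeniusNormSq_le_three_mul_enorm_sq _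
        _ = 3 * ∫⁻ x, ‖iteratedFDeriv ℝ 1 (v t) x‖ₑ ^ 2 := lintegral_const_mul' _ _ (by norm_num)
        _ < ⊤ := ENNReal.mul_lt_top (by norm_num) ((hC₁ t ht).trans_lt ENNReal.coe_lt_top)
    have ifrob : Integrable (fun x => frobeniusNormSq (fderiv ℝ (v t) x)) volume :=
      integrable_of_continuous_of_nonneg (FluidPDE.continuous_frobeniusNormSq_fderiv hcd (by simp))
        (fun x => FluidPDE.frobeniusNormSq_nonneg _) hfin
    calc ∫⁻ x, ‖iteratedFDeriv ℝ 1 (v t) x‖ₑ ^ 2 = ∫⁻ x, ‖fderiv ℝ (v t) x‖ₑ ^ 2 :=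
          lintegral_congr fun x => by rw [← ofReal_norm, norm_iteratedFDeriv_one, ofReal_norm]
      _ ≤ ∫⁻ x, ENNReal.ofReal (frobeniusNormSq (fderiv ℝ (v t) x)) :=
          lintegral_mono fun x => enorm_sq_fderiv_le_ofReal_frobeniusNormSq _
      _ = ENNReal.ofReal (∫ x, frobeniusNormSq (fderiv ℝ (v t) x)) :=
          (ofReal_integral_eq_lintegral_ofReal ifrob
            (Eventually.of_forall fun x => FluidPDE.frobeniusNormSq_nonneg _)).symm
      _ ≤ ENNReal.ofReal Estar := ENNReal.ofReal_le_ofReal hG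
  -- (e) conclusion: for `t < T` pick `T₁ = (t + T)/2`, build a Tao solution on `[0, T₁]`, identify
  refine ⟨Estar, fun t ht => ?_⟩
  set T₁ : ℝ := (t + T) / 2 with hT₁
  have hT₁I : T₁ ∈ Ioo 0 T := ⟨by rw [hT₁]; linarith [ht.1, ht.2], by rw [hT₁]; linarith [ht.2]⟩
  have htT₁ : t ∈ Icc 0 T₁ := ⟨ht.1, by rw [hT₁]; linarith [ht.2]⟩
  obtain ⟨v, q, hv⟩ := exists_isTaoSolutionOn_of_enstrophy_apriori hν hsm hdiv0 hH hT₁I.1 hEstar0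
    (fun T' hT'0 hT'le v q hv => hapriori hT'0 T₁ hT₁I hT'le hv)
  have huv : u t = v t := hcoin T₁ hT₁I hv t htT₁
  have h := hapriori hT₁I.1 T₁ hT₁I le_rfl hv t htT₁
  rw [← huv] at h
  calc ∫⁻ x, ‖fderiv ℝ (u t) x‖ₑ ^ 2 = ∫⁻ x, ‖iteratedFDeriv ℝ 1 (u t) x‖ₑ ^ 2 :=
        lintegral_congr fun x => by rw [← ofReal_norm, ← norm_iteratedFDeriv_one, ofReal_norm]
    _ ≤ ENNReal.ofReal Estar := h

end Summit.NavierStokesRegularity.NavierStokesRegularity.Theorems.ClassBudgetsRegularise.Birth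

end
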